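import Literature.Probability.RandomPlanarGeometry.SAWPulledLargeForceExpansionZdHyperoctahedral
import Literature.Probability.RandomPlanarGeometry.SAWIrreducibleBridgeSpanOne
import Literature.Probability.RandomPlanarGeometry.SAWRatioLimit
import HarnessLib

/-!
# The self-avoiding walk counts `c_n(ℤ^d)` in EVERY dimension: Fisher–Gaunt normal form, integrality in `2d`, and
# CONGRUENCES BETWEEN DIMENSIONS — `4dd′(d−d′) ∣ d′·c_n(ℤ^d) − d·c_n(ℤ^{d′})`, `c_n(ℤ^d) ≡ 2d (mod 4d(d−1))`

Topic `Literature/Probability/RandomPlanarGeometry` (continues `SAWPulledLargeForceExpansionZdHyperoctahedral.lean`: the hyperoctahedral normal form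
`costCoeffZd_eq_sum_classes_mul_descFactorial` and `exists_int_polynomial_costCoeffZd` of the cost census `N_{c,n}(ℤ^{d+1})`; uses
`SAWIrreducibleBridgeSpanOne.costCoeffZd_self_succ` (`N_{n,n+1}(ℤ^{d+1}) = c_n(ℤ^d)`: the span-one irreducible bridges are the lifted SAWs) and
`SAWRatioLimit.count_one_eq_two` (`c_n(ℤ¹) = 2`)).

PRINTED CONTEXT (locators only; nothing is quoted digit-for-digit). Clisby–Liang–Slade (2007) §3.3 eqs. (29)/(31): enumerations decomposed by the number
of dimensions explored, the symmetry factor of the signed permutations of the axes; Madras–Slade (1993) §1.1 eq. (1.1.8) p. 5 (the `1/d` expansion) and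
Appendix C (exact enumerations in general `d`); Graham (2010) §4 ("a polynomial in powers of s⁻¹ = 2d"). The normal form below is the printed device;
the CONGRUENCES are lane statements (not located in print by the lane's searches): an integer polynomial `R` has `a − b ∣ R(a) − R(b)`.

THIS FILE (lane «pcv-sawmu», a-p3 g25; all PROVED, standard axioms, NO definitions):
* ★★★ `count_eq_sum_classes_mul_descFactorial` — **`c_n(ℤ^d) = Σ_{u ≤ n} g_n(u) · 2^u · d(d−1)⋯(d−u+1)`** for every `d`, `g_n(u) ∈ ℕ` the number of
  hyperoctahedral classes of `n`-step SAWs of `ℤ^u` using every axis; ★★★ `exists_int_polynomial_count` — **`c_n(ℤ^d) = C_n(2d)`, `C_n ∈ ℤ[X]`,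
  `deg ≤ n`, `C_n(0) = 0`** (`n ≥ 1`);
* ★★★ `dvd_sub_count` — **`4·d·d′·(d − d′) ∣ d′·c_n(ℤ^d) − d·c_n(ℤ^{d′})`** (`n ≥ 1`); ★★★ `dvd_count_sub_two_mul` — **`c_n(ℤ^d) ≡ 2d (mod 4d(d−1))`**;
  ★★ `four_mul_dvd_count_sub_two_mul` — **`c_n(ℤ^d)/(2d)` is ODD**; ★★ `eight_dvd_count_two_sub_four` (`c_n(ℤ²) ≡ 4 (mod 8)`),
  `dvd_count_three_sub_six` (`c_n(ℤ³) ≡ 6 (mod 24)`); ★★ `dvd_sub_costCoeffZd` — the same congruence for every cost cell `N_{c,n}`, `c ≥ 1`.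
Numerical face (not used): `c₄(ℤ²) = 100 ≡ 4 (8)`, `c₁₁(ℤ²) = 120292 ≡ 4 (8)`, `c₅(ℤ³) = 3534 ≡ 6 (24)`, `c₄(ℤ⁴) = 2696 ≡ 8 (48)`, `2c₃(ℤ³) − 3c₃(ℤ²) = 192 ≡ 0 (24)`.
[cite: ClisbyLiangSlade2007, §3.3 eqs. (29)/(31)] [cite: MadrasSlade1993, §1.1 eq. (1.1.8) p. 5; Appendix C pp. 396–397] [cite: Graham2010, Section 4]

Provenance: lane «pcv-sawmu», a-p3 g25 (2026-08-28). PURE STD, no data, no census value used.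
-/

noncomputable section

open Finset
open scoped BigOperators
open Literature.Probability.LatticeModels
open Literature.Probability.RandomPlanarGeometry.SAW

namespace Literature.Probability.RandomPlanarGeometry.SAW.Zd

/-! ## §8 The SAW counts `c_n(ℤ^d)` themselves: Fisher–Gaunt normal form, integrality in `2d`, congruences between dimensions -/

section Count

/-- ★★★ **THE FISHER–GAUNT / CLISBY–LIANG–SLADE NORMAL FORM OF `c_n(ℤ^d)`**: for every `n` and EVERY `d`,
`c_n(ℤ^d) = Σ_{u=0}^{n} g_n(u) · 2^u · d(d−1)⋯(d−u+1) = Σ_u g_n(u) · 2d(2d−2)⋯(2d−2u+2)` with `g_n(u) ∈ ℕ` the number of classes, under the signed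
permutations of the axes, of the `n`-step self-avoiding walks of `ℤ^u` using every axis ("expansion in the number of dimensions explored"; the tree's
`c_n(ℤ^d) = N_{n,n+1}(ℤ^{d+1})`, `costCoeffZd_self_succ`, makes it the case `c = n`, length `n + 1` of `costCoeffZd_eq_sum_classes_mul_descFactorial`).
[cite: ClisbyLiangSlade2007, §3.3 eqs. (29)/(31)] [cite: MadrasSlade1993, §1.1 eq. (1.1.8) p. 5] [cite: Graham2010, Section 4] -/
theorem count_eq_sum_classes_mul_descFactorial (d n : ℕ) :
    count d n = ∑ u ∈ Finset.range (n + 1),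
      ((irreducibleBridges (u + 1) (n + 1)).filter fun (ω : ℕ → Site (u + 1)) => costZd u (n + 1) ω = n ∧
        ∀ a : Fin (u + 1), a ≠ 0 → ∃ i ≤ n + 1, ω i a ≠ (0 : ℤ)).card / (2 ^ u * u.factorial) * (2 ^ u * d.descFactorial u) := by
  rw [← costCoeffZd_self_succ]
  exact costCoeffZd_eq_sum_classes_mul_descFactorial d n (n + 1)

/-- ★★★ **`c_n(ℤ^d)` IS AN INTEGER POLYNOMIAL IN `2d` WITHOUT CONSTANT TERM** (`n ≥ 1`): `c_n(ℤ^d) = C_n(2d)` for every `d`, with `C_n ∈ ℤ[X]`,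
`deg C_n ≤ n`, `C_n(0) = 0` (`C_1 = X`, `C_2 = X(X−1)`, `C_3 = X(X−1)²`, `C_4 = X⁴ − 3X³ + 3X² + X`, …). [cite: ClisbyLiangSlade2007, §3.3 eqs. (29)/(31)]
[cite: MadrasSlade1993, §1.1 eq. (1.1.8) p. 5] -/
theorem exists_int_polynomial_count {n : ℕ} (hn : 1 ≤ n) :
    ∃ P : Polynomial ℤ, P.natDegree ≤ n ∧ P.coeff 0 = 0 ∧ ∀ d : ℕ, (count d n : ℤ) = P.eval (2 * (d : ℤ)) := by
  obtain ⟨P, hP, hP0, h⟩ := exists_int_polynomial_costCoeffZd n (n + 1)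
  exact ⟨P, hP, hP0 hn, fun d => by rw [← costCoeffZd_self_succ]; exact h d⟩

/-- An integer polynomial in `2d` without constant term satisfies the dimension congruence `4dd′(d−d′) ∣ d′f(d) − d f(d′)`. [folklore] -/
private theorem dvd_sub_of_eval_two_mul {f : ℕ → ℤ} (h : ∃ P : Polynomial ℤ, P.coeff 0 = 0 ∧ ∀ d : ℕ, f d = P.eval (2 * (d : ℤ)))
    (d d' : ℕ) : (4 * (d : ℤ) * d' * ((d : ℤ) - d')) ∣ (d' : ℤ) * f d - (d : ℤ) * f d' := by
  obtain ⟨P, hP0, hP⟩ := h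
  obtain ⟨R, hR⟩ := Polynomial.X_dvd_iff.2 hP0
  obtain ⟨m, hm⟩ := Polynomial.sub_dvd_eval_sub (2 * (d : ℤ)) (2 * (d' : ℤ)) R
  rw [hP d, hP d', hR, Polynomial.eval_mul, Polynomial.eval_mul, Polynomial.eval_X, Polynomial.eval_X]
  exact ⟨m, by linear_combination (2 * (d : ℤ) * d') * hm⟩

/-- ★★★ **THE DIMENSION CONGRUENCE FOR SAW COUNTS**: for every `n ≥ 1` and all `d, d′`,
**`4·d·d′·(d − d′) ∣ d′·c_n(ℤ^d) − d·c_n(ℤ^{d′})`** (e.g. `2c_n(ℤ³) ≡ 3c_n(ℤ²) (mod 24)`: `n = 3`: `2·150 − 3·36 = 192 = 8·24`).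
[cite: ClisbyLiangSlade2007, §3.3 eqs. (29)/(31)] [cite: MadrasSlade1993, §1.1 eq. (1.1.8) p. 5] -/
theorem dvd_sub_count {n : ℕ} (hn : 1 ≤ n) (d d' : ℕ) :
    (4 * (d : ℤ) * d' * ((d : ℤ) - d')) ∣ (d' : ℤ) * count d n - (d : ℤ) * count d' n := by
  obtain ⟨P, -, hP0, h⟩ := exists_int_polynomial_count hn
  exact dvd_sub_of_eval_two_mul ⟨P, hP0, h⟩ d d'

/-- ★★★ **`c_n(ℤ^d) ≡ 2d (mod 4d(d−1))`** for every `n ≥ 1` and every `d` (`c_n(ℤ¹) = 2`): `c_n(ℤ²) ≡ 4 (mod 8)`, `c_n(ℤ³) ≡ 6 (mod 24)`,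
`c_n(ℤ⁴) ≡ 8 (mod 48)`, `c_n(ℤ⁵) ≡ 10 (mod 80)`, … (check: `c₄(ℤ²) = 100 = 12·8 + 4`, `c₅(ℤ³) = 3534 = 147·24 + 6`, `c₄(ℤ⁴) = 2696 = 56·48 + 8`).
[cite: ClisbyLiangSlade2007, §3.3 eqs. (29)/(31)] [cite: MadrasSlade1993, §1.1 eq. (1.1.8) p. 5] -/
theorem dvd_count_sub_two_mul {n : ℕ} (hn : 1 ≤ n) (d : ℕ) :
    (4 * (d : ℤ) * ((d : ℤ) - 1)) ∣ (count d n : ℤ) - 2 * (d : ℤ) := by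
  obtain ⟨m, hm⟩ := dvd_sub_count hn d 1
  rw [count_one_eq_two hn] at hm
  exact ⟨m, by push_cast at hm; linear_combination hm⟩

/-- ★★ **`c_n(ℤ^d)/(2d)` IS ODD**: `4d ∣ c_n(ℤ^d) − 2d` for every `n ≥ 1` and every `d` — the number of `n`-step self-avoiding walks of `ℤ^d` is
`≡ 2d (mod 4d)` (only the one-axis class is odd in the normal form). [cite: ClisbyLiangSlade2007, §3.3 eqs. (29)/(31)] [cite: MadrasSlade1993, §1.1 eq. (1.1.8) p. 5] -/
theorem four_mul_dvd_count_sub_two_mul {n : ℕ} (hn : 1 ≤ n) (d : ℕ) : (4 * (d : ℤ)) ∣ (count d n : ℤ) - 2 * (d : ℤ) :=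
  (dvd_mul_right _ _).trans (dvd_count_sub_two_mul hn d)

/-- ★★ The square lattice: **`c_n(ℤ²) ≡ 4 (mod 8)`** for every `n ≥ 1` (`4, 12, 36, 100, 284, 780, 2172, …`). [cite: MadrasSlade1993, §1.1 eq. (1.1.8) p. 5;
Appendix C (exact enumerations)] -/
theorem eight_dvd_count_two_sub_four {n : ℕ} (hn : 1 ≤ n) : (8 : ℤ) ∣ (count 2 n : ℤ) - 4 := by
  have h := dvd_count_sub_two_mul hn 2
  norm_num at h
  exact h

/-- ★★ The cubic lattice: **`c_n(ℤ³) ≡ 6 (mod 24)`** for every `n ≥ 1` (`6, 30, 150, 726, 3534, 16926, …`). [cite: MadrasSlade1993, §1.1 eq. (1.1.8) p. 5;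
Appendix C (exact enumerations)] -/
theorem dvd_count_three_sub_six {n : ℕ} (hn : 1 ≤ n) : (24 : ℤ) ∣ (count 3 n : ℤ) - 6 := by
  have h := dvd_count_sub_two_mul hn 3
  norm_num at h
  exact h

/-- ★★ THE SAME FOR EVERY COST CELL: for `c ≥ 1`, all `n, d, d′`, `4dd′(d−d′) ∣ d′·N_{c,n}(ℤ^{d+1}) − d·N_{c,n}(ℤ^{d′+1})`; in particular
`N_{c,n}(ℤ^{d+1}) ≡ d·N_{c,n}(ℤ²) (mod 4d(d−1))`. [cite: MadrasSlade1993, §4.2 eq. (4.2.20)–(4.2.22) p. 94] [cite: Graham2010, Section 4] -/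
theorem dvd_sub_costCoeffZd {c : ℕ} (hc : 1 ≤ c) (n d d' : ℕ) :
    (4 * (d : ℤ) * d' * ((d : ℤ) - d')) ∣ (d' : ℤ) * costCoeffZd d c n - (d : ℤ) * costCoeffZd d' c n := by
  obtain ⟨P, -, hP0, h⟩ := exists_int_polynomial_costCoeffZd c n
  exact dvd_sub_of_eval_two_mul ⟨P, hP0 hc, h⟩ d d'

end Count

end Literature.Probability.RandomPlanarGeometry.SAW.Zd

end
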